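import Summits.KontsevichZagierPeriods.Zeta5Search.SymRayZudilin15
import Summits.KontsevichZagierPeriods.Zeta5Search.Zudilin2002Decay
import Summits.KontsevichZagierPeriods.Zeta5Search.Zudilin2002Signs
import Summits.KontsevichZagierPeriods.Zeta5Search.SymmetricFamilyExactRates
import Literature.NumberTheory.Irrationality.Zudilin2002.WellPoisedForms
import HarnessLib

/-!
# Zudilin 2002: (15) in the printed normalisation, Theorem 1's limits, signs and rates — all PROVED (cell `pub-zeta5`, P1)

HONEST FRAMING: systematic search; no irrationality claim unless certified.

OUR work (Summit side), P1 seat generation 3. BRIDGE between the symmetric ray of the wedge dictionary (canonical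
`U, W, V` of `b_n = (3n;n⁷)`, `b'_n = b_n + e₁`; `SymRayZudilin15`) and the literature seat's typed Sect. 2 of Zudilin 2002
(`Zudilin2002/WellPoisedForms.lean`: coefficients `uC wC vC`, `utC wtC vtC` of `rₙ, r̃ₙ` as partial-fraction sums):

* `coeff_ray_eq`, `coeff_ray'_eq`: `(U,W,V)(b_n) = (2/n!⁴)·(uₙ,wₙ,vₙ)` and `(U,W,V)(b'_n) = −(2/n!⁴)·(ũₙ,w̃ₙ,ṽₙ)`
  (the ray summand is `(2/n!⁴)·h_n(t+n+1)`, the partner summand `−(2/n!⁴)·h̃_n(t+n+1)`; poles re-indexed by `n`, the harmonic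
  constant term unchanged because the data vanish at the naturals `< n`, lit's `IsDataR.vC_eq_shift`);
* **`eq15`**: `qₙ = uₙw̃ₙ − ũₙwₙ`, `pₙ = w̃ₙvₙ − wₙṽₙ`, `p̃ₙ = uₙṽₙ − ũₙvₙ` for ALL `n` — Zudilin's (15) exactly as printed
  (`Zudilin2002.q/p/ptilde` vs `minorQ/minorP/minorPt`), hence `minors_isSolution`;
* **`theorem1_limits`**: `pₙ/qₙ → ζ(5)` and `p̃ₙ/qₙ → ζ(3)` (lit's `tendsto_of_minors_isSolution` + `Q_solvesRec_holds`);
* the NAMED FACTS of `Zudilin2002/Recursion.lean` and `BrownZudilin2022/TotallySymmetric.lean` become THEOREMS: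
  **`theorem1_signs_holds : Zudilin2002.theorem1_signs`**, **`theorem1_rates_holds : Zudilin2002.theorem1_rates`**,
  **`bz_rates_holds : BrownZudilin2022.rates`** (via the typer's `theorem1_signs_of_tendsto`, `theorem1_rates_of_tendsto`,
  `rates_of_tendsto`). Row 7 of the cell's NEAR-MISSES table (symmetric family) is thereby unconditional.
-/

noncomputable section

open Finset Filter
open scoped Topology

namespace Summit.KontsevichZagierPeriods.Zeta5Search.SymRay

open Summit.KontsevichZagierPeriods.Zeta5Search.DualSeries
open Summit.KontsevichZagierPeriods.Zeta5Search.WedgeDictionary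
open Literature.NumberTheory.Transcendental
open Literature.NumberTheory.Transcendental.BallRivoal (pfEval harm poch_pos)
open Literature.NumberTheory.Irrationality
open Literature.NumberTheory.Irrationality.Zudilin2002

/-! ### Re-indexed, rescaled data -/

/-- Data of the ray (or its partner) from data `c` of `rₙ` (or `r̃ₙ`): scale by `s` and move pole `p` to pole `p + n`. -/
def rayShift (s : ℚ) (n : ℕ) (c : ℕ → ℕ → ℚ) : ℕ → ℕ → ℚ := fun o p =>
  if n ≤ p ∧ p ≤ 2 * n then s * c o (p - n) else 0

/-- Sums against the shifted data: `Σ_{p≤3n} rayShift s n c o p · g p = s · Σ_{p≤n} c o p · g (p+n)`. -/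
theorem sum_rayShift (s : ℚ) (n : ℕ) (c : ℕ → ℕ → ℚ) (o : ℕ) (g : ℕ → ℚ) :
    ∑ p ∈ range (3 * n + 1), rayShift s n c o p * g p = s * ∑ p ∈ range (n + 1), c o p * g (p + n) := by
  have hsplit : range (3 * n + 1) = Ico 0 n ∪ Ico n (3 * n + 1) := by
    rw [range_eq_Ico, Ico_union_Ico_eq_Ico (by omega) (by omega)]
  rw [hsplit, sum_union (Ico_disjoint_Ico_consecutive 0 n (3 * n + 1)),
    sum_eq_zero (fun p hp => by rw [rayShift, if_neg (by have := (mem_Ico.1 hp).2; omega), zero_mul]), zero_add,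
    ← Ico_union_Ico_eq_Ico (show n ≤ 2 * n + 1 by omega) (show 2 * n + 1 ≤ 3 * n + 1 by omega),
    sum_union (Ico_disjoint_Ico_consecutive n (2 * n + 1) (3 * n + 1)),
    sum_eq_zero (s := Ico (2 * n + 1) (3 * n + 1))
      (fun p hp => by rw [rayShift, if_neg (by have := (mem_Ico.1 hp).1; omega), zero_mul]), add_zero,
    sum_Ico_eq_sum_range, show 2 * n + 1 - n = n + 1 by omega, mul_sum]
  refine sum_congr rfl fun k hk => ?_
  have hk' := mem_range.1 hk
  rw [rayShift, if_pos ⟨by omega, by omega⟩, show n + k - n = k by omega, add_comm n k]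
  ring

/-- Evaluation of the shifted data: `pfEval (3n) 6 (rayShift s n c) t = s · pfEval n 6 c (t + n)`. -/
theorem pfEval_rayShift (s : ℚ) (n : ℕ) (c : ℕ → ℕ → ℚ) (t : ℚ) :
    pfEval (3 * n) 6 (rayShift s n c) t = s * pfEval n 6 c (t + n) := by
  unfold pfEval
  simp_rw [mul_sum]
  conv_lhs => rw [sum_comm]
  conv_rhs => rw [sum_comm]
  refine sum_congr rfl fun o _ => ?_
  have h := sum_rayShift s n c o (fun p => 1 / (t + p + 1) ^ (o + 1))
  simp only [div_eq_mul_one_div (rayShift _ _ _ _ _)]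
  rw [h, mul_sum]
  refine sum_congr rfl fun p _ => ?_
  push_cast
  ring

/-! ### The ray data ARE the rescaled, re-indexed data of `rₙ`, `r̃ₙ` -/

/-- `numPoly_{bRay n}(t+1)/((t+1)_{3n+1})⁶ = (2/n!⁴)·numR n (t+n+1)/((t+n+1)_{n+1})⁶` off the poles. -/
theorem ray_eq_numR (n : ℕ) (t : ℚ) (ht : ∀ p, p ≤ 3 * n → t + p + 1 ≠ 0) :
    (2 * t + 3 * n + 2) * (BallRivoal.poch (t + 1) n * BallRivoal.poch (t + 2 * n + 2) n) ^ 7 /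
        BallRivoal.poch (t + 1) (3 * n + 1) ^ 6 =
      2 / (n.factorial : ℚ) ^ 4 * ((numR n).eval (t + n + 1) / BallRivoal.poch (t + n + 1) (n + 1) ^ 6) := by
  rw [eval_numR, poch_ray_split]
  have hA : BallRivoal.poch (t + 1) n ≠ 0 := by
    rw [BallRivoal.poch]; exact prod_ne_zero_iff.2 fun s hs => by
      have := ht s (by have := mem_range.1 hs; omega); intro h; apply this; linarith
  have hC : BallRivoal.poch (t + 2 * n + 2) n ≠ 0 := by
    rw [BallRivoal.poch]; exact prod_ne_zero_iff.2 fun s hs => by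
      have := ht (2 * n + 1 + s) (by have := mem_range.1 hs; omega); intro h; apply this; push_cast; linarith
  have hE : BallRivoal.poch (t + n + 1) (n + 1) ≠ 0 := by
    rw [BallRivoal.poch]; exact prod_ne_zero_iff.2 fun s hs => by
      have := ht (n + s) (by have := mem_range.1 hs; omega); intro h; apply this; push_cast; linarith
  have hf : (n.factorial : ℚ) ≠ 0 := by positivity
  rw [show t + (n : ℚ) + 1 - n = t + 1 by ring, show t + (n : ℚ) + 1 + n + 1 = t + 2 * n + 2 by ring]
  field_simp
  ring

/-- For data `c` of `rₙ`, `rayShift (2/n!⁴) n c` is partial-fraction data of the ray `bRay n`. -/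
theorem isPFData_rayShift {n : ℕ} {c : ℕ → ℕ → ℚ} (hc : IsDataR n c) :
    IsPFData (bRay n) (rayShift (2 / (n.factorial : ℚ) ^ 4) n c) := by
  intro t ht
  rw [bRay_zero_toNat] at ht ⊢
  have hpole : ∀ p, p ≤ n → t + (n : ℚ) + p + 1 ≠ 0 := fun p hp => by
    have := ht (p + n) (by omega); push_cast at this; intro h; apply this; linarith
  rw [eval_numPoly_bRay, pfEval_rayShift, ray_eq_numR n t ht, hc (t + n) hpole, Polynomial.eval_comp, Polynomial.eval_add,
    Polynomial.eval_X, Polynomial.eval_C]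

/-- For data `c` of `r̃ₙ`, `rayShift (−2/n!⁴) n c` is partial-fraction data of the partner `bRay' n`. -/
theorem isPFData_rayShift' {n : ℕ} {c : ℕ → ℕ → ℚ} (hc : IsDataRt n c) :
    IsPFData (bRay' n) (rayShift (-(2 / (n.factorial : ℚ) ^ 4)) n c) := by
  intro t ht
  rw [bRay'_zero_toNat] at ht ⊢
  have hpole : ∀ p, p ≤ n → t + (n : ℚ) + p + 1 ≠ 0 := fun p hp => by
    have := ht (p + n) (by omega); push_cast at this; intro h; apply this; linarith
  rw [eval_numPoly_bRay', pfEval_rayShift, hc (t + n) hpole, Polynomial.eval_comp, Polynomial.eval_add, Polynomial.eval_X,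
    Polynomial.eval_C, eval_numRt]
  have h := ray_eq_numR n t ht
  rw [show (2 * t + 3 * (n : ℚ) + 2) * (BallRivoal.poch (t + 1) n * BallRivoal.poch (t + 2 * n + 2) n) ^ 7 *
      ((t + n + 1) * (t + 2 * n + 1)) / BallRivoal.poch (t + 1) (3 * n + 1) ^ 6 =
      ((t + n + 1) * (t + 2 * n + 1)) * ((2 * t + 3 * (n : ℚ) + 2) *
        (BallRivoal.poch (t + 1) n * BallRivoal.poch (t + 2 * n + 2) n) ^ 7 / BallRivoal.poch (t + 1) (3 * n + 1) ^ 6) by ring,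
    h]
  ring

/-! ### The canonical coefficients of the ray in Zudilin's normalisation -/

/-- **`(U, W, V)(b_n) = (2/n!⁴)·(uₙ, wₙ, vₙ)`.** -/
theorem coeff_ray_eq (n : ℕ) :
    coeffU (bRay n) = 2 / (n.factorial : ℚ) ^ 4 * uC n ∧ coeffW (bRay n) = 2 / (n.factorial : ℚ) ^ 4 * wC n ∧
      coeffV (bRay n) = 2 / (n.factorial : ℚ) ^ 4 * vC n := by
  have hc := isDataR_dataR n
  have hd := isPFData_rayShift hc
  refine ⟨?_, ?_, ?_⟩
  · rw [coeffU_eq hd, bRay_zero_toNat, uC_eq hc]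
    have := sum_rayShift (2 / (n.factorial : ℚ) ^ 4) n (dataR n) 4 (fun _ => 1)
    simp only [mul_one] at this
    exact this
  · rw [coeffW_eq hd, bRay_zero_toNat, wC_eq hc]
    have := sum_rayShift (2 / (n.factorial : ℚ) ^ 4) n (dataR n) 2 (fun _ => 1)
    simp only [mul_one] at this
    exact this
  · rw [coeffV_eq hd, bRay_zero_toNat, ← hc.vC_eq_shift le_rfl, mul_sum]
    exact sum_congr rfl fun o _ => sum_rayShift _ n (dataR n) o (fun p => harm (o + 1) p)

/-- **`(U, W, V)(b'_n) = −(2/n!⁴)·(ũₙ, w̃ₙ, ṽₙ)`.** -/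
theorem coeff_ray'_eq (n : ℕ) :
    coeffU (bRay' n) = -(2 / (n.factorial : ℚ) ^ 4) * utC n ∧ coeffW (bRay' n) = -(2 / (n.factorial : ℚ) ^ 4) * wtC n ∧
      coeffV (bRay' n) = -(2 / (n.factorial : ℚ) ^ 4) * vtC n := by
  have hc := isDataRt_dataRt n
  have hd := isPFData_rayShift' hc
  refine ⟨?_, ?_, ?_⟩
  · rw [coeffU_eq hd, bRay'_zero_toNat, utC_eq hc]
    have := sum_rayShift (-(2 / (n.factorial : ℚ) ^ 4)) n (dataRt n) 4 (fun _ => 1)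
    simp only [mul_one] at this
    exact this
  · rw [coeffW_eq hd, bRay'_zero_toNat, wtC_eq hc]
    have := sum_rayShift (-(2 / (n.factorial : ℚ) ^ 4)) n (dataRt n) 2 (fun _ => 1)
    simp only [mul_one] at this
    exact this
  · rw [coeffV_eq hd, bRay'_zero_toNat, ← hc.vtC_eq_shift le_rfl, mul_sum]
    exact sum_congr rfl fun o _ => sum_rayShift _ n (dataRt n) o (fun p => harm (o + 1) p)

/-! ### (15) as printed, and Theorem 1 -/

/-- **Zudilin's (15), all `n`, in the printed normalisation**: `qₙ = uₙw̃ₙ − ũₙwₙ`, `pₙ = w̃ₙvₙ − wₙṽₙ`, `p̃ₙ = uₙṽₙ − ũₙvₙ`. -/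
theorem eq15 (n : ℕ) : q n = minorQ n ∧ p n = minorP n ∧ ptilde n = minorPt n := by
  obtain ⟨hU, hW, hV⟩ := coeff_ray_eq n
  obtain ⟨hU', hW', hV'⟩ := coeff_ray'_eq n
  have hf : (n.factorial : ℚ) ≠ 0 := by positivity
  refine ⟨?_, ?_, ?_⟩
  · rw [zudilin15_q, hU, hW, hU', hW', minorQ]; field_simp; ring
  · rw [zudilin15_p, hV, hW, hV', hW', minorP]; field_simp; ring
  · rw [zudilin15_ptilde, hU, hV, hU', hV', minorPt]; field_simp; ring

/-- The three minor sequences solve the recursion (1). -/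
theorem minors_isSolution : IsSolution minorQ ∧ IsSolution minorP ∧ IsSolution minorPt := by
  have hq : minorQ = q := funext fun n => ((eq15 n).1).symm
  have hp : minorP = p := funext fun n => ((eq15 n).2.1).symm
  have hpt : minorPt = ptilde := funext fun n => ((eq15 n).2.2).symm
  rw [hq, hp, hpt]
  exact ⟨sol_isSolution _ _ _, sol_isSolution _ _ _, sol_isSolution _ _ _⟩

/-- **Theorem 1's two limits**: `pₙ/qₙ → ζ(5)` and `p̃ₙ/qₙ → ζ(3)`. -/
theorem theorem1_limits :
    Tendsto (fun n : ℕ => (p n : ℝ) / q n) atTop (𝓝 (zetaValue 5)) ∧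
      Tendsto (fun n : ℕ => (ptilde n : ℝ) / q n) atTop (𝓝 (zetaValue 3)) :=
  tendsto_of_minors_isSolution SymmetricRecursion.Q_solvesRec_holds minors_isSolution.1 minors_isSolution.2.1
    minors_isSolution.2.2

/-- **Zudilin 2002, Theorem 1, signs (3)** — the named fact `Zudilin2002.theorem1_signs` is a THEOREM. -/
theorem theorem1_signs_holds : theorem1_signs :=
  Zudilin2002Growth.theorem1_signs_of_tendsto theorem1_limits.1 theorem1_limits.2

/-- **Zudilin 2002, Theorem 1, rates (4)–(5)** — the named fact `Zudilin2002.theorem1_rates` is a THEOREM. -/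
theorem theorem1_rates_holds : theorem1_rates :=
  Zudilin2002Growth.theorem1_rates_of_tendsto theorem1_limits.1 theorem1_limits.2

/-- **Brown–Zudilin 2022, Sect. 2 rates** — the named fact `BrownZudilin2022.rates` is a THEOREM. -/
theorem bz_rates_holds : BrownZudilin2022.rates :=
  SymmetricFamilyRates.rates_of_tendsto theorem1_limits.1 theorem1_limits.2

end Summit.KontsevichZagierPeriods.Zeta5Search.SymRay
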